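import Literature.AnabelianGeometry.EtaleTheta.GalSectChiTateModuleDictionary
import Literature.AnabelianGeometry.EtaleTheta.GalSectCuspCyclotomicInertia
import Literature.AnabelianGeometry.EtaleTheta.GalSectDotCCuspOfStructureGroupIso
import Literature.AnabelianGeometry.EtaleTheta.GalSectKxHatTorsion
import Literature.NumberTheory.GaloisRepresentations.ContinuousCohomologyTransport
import HarnessLib

/-!
# [GalSect] §4: the structure group of the cusp torsor IS `(K^×)^∧` — `Ker(res) ≅ H¹(D/I, I) ≅ H¹(G_K, Ẑ(1)) ≅ (K^×)^∧`
# from «`I ≅ Ẑ(1)`» + «`D` compact» + «`D ↠ G_K`»; the [EtTh] Thm 1.10 (iii) binder (gen) DERIVED from print-level clauses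

S. Mochizuki, *Galois sections in absolute anabelian geometry* [GalSect], Nagoya Math. J. **179** (2005), §4 p. 33: «we have an
exact sequence `1 → I_x → D_x → G_K → 1`, `I_x ≅ Ẑ(1)` … the splittings … form a torsor over `H¹(G_K, Ẑ(1)) ≅ (K^×)^∧`»
[cite: MochizukiGalSect2005, §4 p.33]; S. Mochizuki, *The étale theta function …* [EtTh], Publ. RIMS **45** (2009), Thm. 1.10 (iii)
p. 30 (the `(K^×_□)^∧`-torsor at the unique cusp of `Ċ^log_□`) [cite: MochizukiEtTh2009, Thm 1.10 (iii) p.30]; inflation–restriction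
and Kummer theory [cite: NeukirchSchmidtWingberg2008, I §2 and II §7], [cite: SerreGaloisCohomology1997, II §1.2].

abc-iut cell, layer L2, seat abc-iut-w5-d029 (gen 7), row «(GEN)-FROM-PRINT-CLAUSES» — sequel (S1) of the C7e lineage
(p452745 clause (1) `IsCyclotomic`; p454786 `DotCCusp.ofStructureGroupIso` / `IsGenuineTorsor`; p456299; p461520).  The v3 END-KNIT
closers of EtTh:Thm1.10(iii) (`thm110iiiGalSect_of_Xlevel_v3`, abc-iut-w5-d062 / w5-d140) carry the binder

  (gen)  `∃ κ : (K^×)^∧ ≃* Ker(res : H¹(D, I) → H¹(I, I))` (through which the cusp torsor IS `torsorDataH1`).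

THIS PROOF-ONLY FILE (no definition, no `Prop` fact, no instance) PRODUCES `κ` from the PRINT-LEVEL clauses of [GalSect] §4:

* `GalSect.CuspPair.nonempty_completion_mulEquiv_resKer_of_isCyclotomic` — for a cuspidal pair `P = (D, I)` in a `T₁`
  topological group `Γ` with continuous augmentation `α : Γ → G_{ℚ_p}`, a field `K` with all `K^×/(K^×)ⁿ` finite, `L ≤ G_{ℚ_p}`
  with `Φ : L ≃ₜ* Gal(K^al/K)`, `ι : K^al ≃ ℚ̄_p`, `ι(Φ(σ)x) = σ(ιx)`:  **`P.IsCyclotomic α` («`I ≅ Ẑ(1)`», C7e (1)) + `D` compact +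
  «`I = D ∩ Ker α`» + «`α(D) = L`» ⇒ `Nonempty ((K^×)^∧ ≃* Ker(res))`.**  ROUTE: `Ker(res) ≃* H¹(D/I, I)` (abc-iut-L2-t12's
  `ContH1.kerResEquivQuotient` / this lineage's `CuspPair.resKerEquivH1Quotient`) ∘ `H¹`-transport along `D/I ≃ₜ* L ≃ₜ* Gal(K^al/K)`
  (`exists_quotient_continuousMulEquiv_of_isCompact`, abc-iut-L4's `continuousCohomologyAddEquivOfContinuousMulEquiv`) with the
  coefficient dictionary «`Ẑ` through `χ ∘ α`» `= T_μ(K^al)` (`exists_chi_tateModule_dictionary`) ∘ Kummer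
  `H¹_cont(Gal(K^al/K), T_μ) ≃ (K^×)^∧` (abc-iut-L4-t11's `continuousCohomologyOneTateModuleEquivCompletion`);
* `GalSect.nonempty_kxHat_mulEquiv_resKer_of_isCyclotomicCusp` — at a cusp `x` of `X : TemperedCurve p`: `IsCyclotomicCusp X x` +
  `D_x` compact + «`aug(D_x) = G_K`» (`x` is `K`-rational) ⇒ `Nonempty (KxHat X ≃* Ker(res))` for `(D_x, I_x)` (junction
  `exists_GK_continuousMulEquiv_absoluteGaloisGroup`, abc-iut-w6-d047; `hfin` = `finiteIndex_range_powMonoidHom_units_padic`);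
* `MuTwoSetting.DotCCusp.exists_isGenuineTorsor_and_isCyclotomicInertia_of_isCyclotomicCusp` — **the (gen) binder from print-level
  clauses**: a C-level datum, a cusp `x` with `D_x ≤ Π^tp_Ẍ`, a splitting, `IsCyclotomicCusp`, `D_x` compact, `aug(D_x) = G_K`
  ⇒ `∃ C : M.DotCCusp εZ, C.IsGenuineTorsor ∧ C.IsCyclotomicInertia ∧ C.pair = (inclX D_x, inclX I_x)` (via `ofStructureGroupIso`).

CENSUS READING (K2 / EtTh:Thm1.10(iii), binder (gen)): (gen) ⟸ {C7e clause (1) «`I_x ≅ Ẑ(1)`», `IsCompact D_x` (NOT a clause of the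
frozen `TemperedCurve` interface, which records only `isClosed_decomp`), «`aug(D_x) = G_K`»} + tree theorems.  HONEST FRAMING: no carrier of
the model zoo meets clause (1) ∧ `DotCCusp` tonight (GAP row G-L2t5-1), so this is a DERIVATION between binders, not a non-vacuity
instance; [GalSect] is refereed; nothing of [EtTh] is asserted; no side taken on [IUTchIII] Cor. 3.12; typed ≠ proved.
-/

noncomputable section

namespace Literature.AnabelianGeometry.EtaleTheta

open Literature.AnabelianGeometry.SemiGraphs
open Literature.NumberTheory.GaloisRepresentations
open Literature.NumberTheory.GaloisRepresentations.DiscreteGaloisModule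
open CategoryTheory ProfiniteGrp ProfiniteGrp.ProfiniteCompletion
open _root_.Topology _root_.Function
open scoped Pointwise IsMulCommutative

/-! ### §1. The abstract theorem: `(K^×)^∧ ≃* Ker(res)` for a cyclotomic, compact, `L`-rational cuspidal pair -/

namespace GalSect.CuspPair

variable {p : ℕ} [Fact p.Prime]

/-- **[GalSect] §4: the structure group of the cusp torsor is `(K^×)^∧`.**  Let `P = (D, I)` be a cuspidal pair in a `T₁` topological
group `Γ` with continuous augmentation `α : Γ → G_{ℚ_p}`; `K` a field of characteristic `0` with all `K^×/(K^×)ⁿ` of finite index;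
`L ≤ G_{ℚ_p}` with `Φ : L ≃ₜ* Gal(K^al/K)` and a ring isomorphism `ι : K^al ≅ ℚ̄_p` such that `ι(Φ(σ)x) = σ(ιx)`.  If `(D, I)` is
CYCLOTOMIC for `α` («`I ≅ Ẑ(1)`»: conjugation by `d ∈ D` is `χ(α d)`), `D` is COMPACT, `I = D ∩ Ker α` and `α(D) = L` («`D/I = G_K`»), then
`(K^×)^∧ ≃* Ker(res : H¹(D, I) → H¹(I, I))` — inflation `Ker(res) = H¹(D/I, I)`, transport along `D/I ≃ G_K` with `I = Ẑ(1) = T_μ`,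
and Kummer theory `H¹(G_K, Ẑ(1)) ≅ (K^×)^∧`. [cite: MochizukiGalSect2005, §4 p.33] -/
theorem nonempty_completion_mulEquiv_resKer_of_isCyclotomic
    {Γ : Type} [Group Γ] [TopologicalSpace Γ] [IsTopologicalGroup Γ] [T1Space Γ]
    (P : CuspPair Γ) [IsMulCommutative P.I] (α : Γ →ₜ* GQp p)
    (K : Type) [Field K] [CharZero K] (hfin : ∀ n : ℕ+, ((powMonoidHom (n : ℕ) : Kˣ →* Kˣ).range).FiniteIndex)
    (L : Subgroup (GQp p)) (Φ : L ≃ₜ* Field.absoluteGaloisGroup K) (ι : AlgebraicClosure K ≃+* PadicAlgCl p)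
    (hΦ : ∀ (σ : L) (x : AlgebraicClosure K), ι (Φ σ • x) = (σ : GQp p) • ι x)
    (hcyc : P.IsCyclotomic α.toMonoidHom) (hDc : IsCompact (P.D : Set Γ))
    (hI : ∀ d ∈ P.D, d ∈ P.I ↔ α d = 1) (hrat : P.D.map α.toMonoidHom = L)
    {S₀ : Subgroup Γ} (hS₀ : S₀ ∈ P.splittings) :
    haveI := P.ID_normal
    Nonempty (completion (GrpCat.of Kˣ) ≃*
      ContH1.resKer P.ID (⊤ : Subgroup P.D) (P.isClosedComplement_of_mem_splittings hS₀).le_left) := by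
  classical
  haveI := P.ID_normal
  obtain ⟨θ, hθ⟩ := P.exists_quotient_continuousMulEquiv_of_isCompact α L hDc hI hrat
  obtain ⟨m, hmc, hmb, hmadd, hmχ⟩ := exists_chi_tateModule_dictionary (p := p) K L Φ ι hΦ
  obtain ⟨e, he⟩ := hcyc
  -- the group isomorphism `D/I ≃ₜ* Gal(K^al/K)`
  let E : (↥(⊤ : Subgroup P.D) ⧸ (P.ID.subgroupOf ⊤)) ≃ₜ* Field.absoluteGaloisGroup K := θ.trans Φ
  -- `m` is a homeomorphism `Ẑ ≃ₜ T_μ` (continuous bijection, compact source, Hausdorff target)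
  let mH : ZHat ≃ₜ (muSystem K).limit := Continuous.homeoOfEquivCompactToT2 (f := Equiv.ofBijective m hmb) hmc
  -- `↥(P.ID) ↔ ↥(P.I)` (same underlying elements of `Γ`)
  let jI : P.ID → P.I := fun a => ⟨((a : P.D) : Γ), Subgroup.mem_subgroupOf.mp a.2⟩
  have hjI : ∀ a : P.ID, ((jI a : P.I) : Γ) = ((a : P.D) : Γ) := fun _ => rfl
  let jI' : P.I → P.ID := fun i => ⟨⟨(i : Γ), P.I_le i.2⟩, Subgroup.mem_subgroupOf.mpr i.2⟩
  have hjI'c : Continuous jI' := Continuous.subtype_mk (Continuous.subtype_mk continuous_subtype_val _) _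
  have hjIc : Continuous jI := Continuous.subtype_mk (continuous_subtype_val.comp continuous_subtype_val) _
  -- the coefficient dictionary `Additive ↥(P.ID) ≃L[ℤ] T_μ(K^al)`, `a ↦ m (e a)`
  let F₀ : Additive P.ID ≃ (muSystem K).limit :=
    (Additive.toMul.trans ⟨jI, jI', fun _ => rfl, fun _ => rfl⟩).trans (e.toEquiv.trans mH.toEquiv)
  have hF₀ : ∀ a : Additive P.ID, F₀ a = m (e (jI (Additive.toMul a))) := fun _ => rfl
  have hF₀add : ∀ a b : Additive P.ID, F₀ (a + b) = F₀ a + F₀ b := fun a b => by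
    rw [hF₀, hF₀, hF₀, toMul_add]
    have : jI (Additive.toMul a * Additive.toMul b) = jI (Additive.toMul a) * jI (Additive.toMul b) := rfl
    rw [this, map_mul, hmadd]
  let F₁ : Additive P.ID ≃+ (muSystem K).limit := { F₀ with map_add' := hF₀add }
  have hF₁c : Continuous F₁ := by
    change Continuous fun a : Additive P.ID => m (e (jI (Additive.toMul a)))
    exact hmc.comp (e.continuous.comp (hjIc.comp continuous_toMul))
  have hF₁c' : Continuous F₁.symm := by
    change Continuous fun y : (muSystem K).limit => Additive.ofMul (jI' (e.symm (mH.symm y)))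
    exact continuous_ofMul.comp (hjI'c.comp (e.symm.continuous.comp mH.symm.continuous))
  let F : Additive P.ID ≃L[ℤ] (muSystem K).limit :=
    { F₁.toIntLinearEquiv with continuous_toFun := hF₁c, continuous_invFun := hF₁c' }
  have hF : ∀ a : Additive P.ID, F a = m (e (jI (Additive.toMul a))) := fun _ => rfl
  -- the two topological representations
  let X₁ : TopRep ℤ (↥(⊤ : Subgroup P.D) ⧸ (P.ID.subgroupOf ⊤)) :=
    quotConjTopRep (MonoidHom.id P.D) P.ID ⊤ P.conjNormal_ID_eq
  let Y : TopRep ℤ (Field.absoluteGaloisGroup K) := (tateModuleMu K).toTopRep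
  -- CORE: `F` intertwines conjugation on `I` (read through `E`) with the Galois action on `T_μ` —
  -- this is exactly «`I ≅ Ẑ(1)`»: conjugation by `d` is `χ(α d)`, and `χ` IS the Galois action on roots of unity
  have hcore : ∀ (q : ↥(⊤ : Subgroup P.D) ⧸ (P.ID.subgroupOf ⊤)) (a : Additive P.ID),
      F (X₁.ρ q a) = Y.ρ (E q) (F a) := by
    intro q a
    induction q using QuotientGroup.induction_on with
    | H d =>
      have hmem : α ((d : P.D) : Γ) ∈ L := by rw [← hrat]; exact ⟨(d : P.D), (d : P.D).2, rfl⟩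
      have hEd : E (QuotientGroup.mk d) = Φ ⟨α ((d : P.D) : Γ), hmem⟩ := by
        change Φ (θ (QuotientGroup.mk d)) = _
        congr 1
        exact Subtype.ext (hθ d)
      rw [hEd, hF, hF]
      change m (e (jI (MulAut.conjNormal ((MonoidHom.id P.D) (d : P.D)) (Additive.toMul a)))) =
        tateModuleMu K (Φ ⟨α ((d : P.D) : Γ), hmem⟩) (m (e (jI (Additive.toMul a))))
      rw [← hmχ]
      have hconj : jI (MulAut.conjNormal ((MonoidHom.id P.D) (d : P.D)) (Additive.toMul a)) =
          ⟨((d : P.D) : Γ) * (jI (Additive.toMul a) : Γ) * ((d : P.D) : Γ)⁻¹,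
            P.conj_mem_I (d : P.D).2 (jI (Additive.toMul a)).2⟩ := by
        apply Subtype.ext
        rw [hjI, MonoidHom.id_apply, MulAut.conjNormal_apply]
        rfl
      refine congrArg m ?_
      rw [hconj]
      exact he _ (d : P.D).2 _
  -- the compatible pair of coefficient morphisms over `E`
  let φ : TopRep.res ((E.symm : Field.absoluteGaloisGroup K →ₜ* (↥(⊤ : Subgroup P.D) ⧸ (P.ID.subgroupOf ⊤))) :
      Field.absoluteGaloisGroup K →* (↥(⊤ : Subgroup P.D) ⧸ (P.ID.subgroupOf ⊤))) X₁ ⟶ Y :=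
    TopRep.ofHom ⟨(F : Additive P.ID →L[ℤ] (muSystem K).limit), fun γ => ContinuousLinearMap.ext fun a => by
      change F (X₁.ρ (E.symm γ) a) = Y.ρ γ (F a)
      rw [hcore, ContinuousMulEquiv.apply_symm_apply]⟩
  let ψ : TopRep.res ((E : (↥(⊤ : Subgroup P.D) ⧸ (P.ID.subgroupOf ⊤)) →ₜ* Field.absoluteGaloisGroup K) :
      (↥(⊤ : Subgroup P.D) ⧸ (P.ID.subgroupOf ⊤)) →* Field.absoluteGaloisGroup K) Y ⟶ X₁ :=
    TopRep.ofHom ⟨(F.symm : (muSystem K).limit →L[ℤ] Additive P.ID), fun q => ContinuousLinearMap.ext fun y => by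
      change F.symm (Y.ρ (E q) y) = X₁.ρ q (F.symm y)
      apply F.injective
      rw [hcore, ContinuousLinearEquiv.apply_symm_apply, ContinuousLinearEquiv.apply_symm_apply]⟩
  have hψφ : ∀ x : X₁, ψ.hom (φ.hom x) = x := fun x => F.symm_apply_apply x
  have hφψ : ∀ y : Y, φ.hom (ψ.hom y) = y := fun y => F.apply_symm_apply y
  -- `H¹`-transport along `E`, Kummer theory, inflation–restriction
  let T : continuousCohomology 1 X₁ ≃+ continuousCohomology 1 Y :=
    continuousCohomologyAddEquivOfContinuousMulEquiv E φ ψ hψφ hφψ 1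
  let Ku : continuousCohomology 1 Y ≃+ Additive (completion (GrpCat.of Kˣ)) :=
    continuousCohomologyOneTateModuleEquivCompletion K hfin
  exact ⟨((P.resKerEquivH1Quotient hS₀).trans (AddEquiv.toMultiplicativeLeft (T.trans Ku))).symm⟩

end GalSect.CuspPair

/-! ### §2. At a cusp of a tempered curve -/

namespace GalSect

variable {p : ℕ} [Fact p.Prime]

/-- **`(K^×)^∧ ≃* Ker(res)` at a `K`-rational cyclotomic cusp** of `X : TemperedCurve p` ([GalSect] §4 p. 33): if the cusp `x` is
CYCLOTOMIC (`IsCyclotomicCusp X x`: «`I_x ≅ Ẑ(1)`» as a `D_x`-module), `D_x` is compact and `aug(D_x) = G_K`, then for every splitting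
`S₀` the structure group `Ker(res : H¹(D_x, I_x) → H¹(I_x, I_x))` of the torsor `cuspTorsorH1` is `KxHat X = (K^×)^∧`.
[cite: MochizukiGalSect2005, §4 p.33] -/
theorem nonempty_kxHat_mulEquiv_resKer_of_isCyclotomicCusp (X : TemperedCurve p) [T1Space X.PiTemp]
    {x : X.Pt} (hx : X.IsCusp x) (hcyc : IsCyclotomicCusp X x) (hDc : IsCompact (X.decomp x : Set X.PiTemp))
    (hrat : (X.decomp x).map X.aug.toMonoidHom = X.GK)
    {S₀ : Subgroup X.PiTemp} (hS₀ : S₀ ∈ (cuspPairOf X x).splittings) :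
    haveI : IsMulCommutative (cuspPairOf X x).I := X.isMulCommutative_inertia hx
    haveI := (cuspPairOf X x).ID_normal
    Nonempty (KxHat X ≃* ContH1.resKer (cuspPairOf X x).ID (⊤ : Subgroup (cuspPairOf X x).D)
      ((cuspPairOf X x).isClosedComplement_of_mem_splittings hS₀).le_left) := by
  haveI : IsMulCommutative (cuspPairOf X x).I := X.isMulCommutative_inertia hx
  haveI : FiniteDimensional ℚ_[p] ↥X.K := X.finiteDimensional_K
  haveI : CharZero ↥X.K := charZero_of_injective_algebraMap (algebraMap ℚ_[p] ↥X.K).injective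
  obtain ⟨ι, Φ, hΦ⟩ := exists_GK_continuousMulEquiv_absoluteGaloisGroup X
  exact (cuspPairOf X x).nonempty_completion_mulEquiv_resKer_of_isCyclotomic X.aug ↥X.K
    (fun n => finiteIndex_range_powMonoidHom_units_padic (p := p) ↥X.K n n.ne_zero) X.GK Φ ι.toRingEquiv
    (fun σ y => hΦ σ y) hcyc hDc (fun d hd => ⟨fun h => h.2, fun h => ⟨hd, h⟩⟩) hrat hS₀

end GalSect

/-! ### §3. [EtTh] Thm 1.10 (iii)'s cusp datum: (gen) from print-level clauses -/

namespace MuTwoSetting.DotCCusp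

open GalSect

variable {p : ℕ} [Fact p.Prime] {M : MuTwoSetting p}
  (e : M.CLevelData) (εZ : M.GtpC) {x : M.Pt} (hx : M.IsCusp x) (hD : M.decomp x ≤ M.GtpXdd)
  {S₀ : Subgroup M.PiTemp} (hS₀ : S₀ ∈ (cuspPairOf M.toTemperedCurve x).splittings)

/-- **`(K^×)^∧ ≃* Ker(res)` for the pushed pair `(inclX D_x, inclX I_x)` in `Π^tp_C`** (the pair of [EtTh] Thm 1.10 (iii)'s cusp
datum), from `IsCyclotomicCusp` + `D_x` compact + `aug(D_x) = G_K` (augmentation `augC` of the C-level datum, `augC ∘ inclX = aug`).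
[cite: MochizukiEtTh2009, Thm 1.10 (iii) p.30] -/
theorem nonempty_kxHat_mulEquiv_resKer_pushforward_of_isCyclotomicCusp (hcyc : IsCyclotomicCusp M.toTemperedCurve x)
    (hDc : IsCompact (M.decomp x : Set M.PiTemp)) (hrat : (M.decomp x).map M.aug.toMonoidHom = M.toTemperedCurve.GK) :
    haveI := M.t1Space_GtpC e
    haveI := isMulCommutative_pushforward_I e hx
    haveI := ((cuspPairOf M.toTemperedCurve x).pushforward M.inclX).ID_normal
    Nonempty (KxHat M.toTemperedCurve ≃*
      ContH1.resKer ((cuspPairOf M.toTemperedCurve x).pushforward M.inclX).ID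
        (⊤ : Subgroup ((cuspPairOf M.toTemperedCurve x).pushforward M.inclX).D)
        (((cuspPairOf M.toTemperedCurve x).pushforward M.inclX).isClosedComplement_of_mem_splittings
          (map_inclX_mem_splittings e hS₀)).le_left) := by
  haveI := M.t1Space_GtpC e
  haveI := isMulCommutative_pushforward_I e hx
  haveI : FiniteDimensional ℚ_[p] ↥M.toTemperedCurve.K := M.toTemperedCurve.finiteDimensional_K
  haveI : CharZero ↥M.toTemperedCurve.K :=
    charZero_of_injective_algebraMap (algebraMap ℚ_[p] ↥M.toTemperedCurve.K).injective
  obtain ⟨ι, Φ, hΦ⟩ := exists_GK_continuousMulEquiv_absoluteGaloisGroup M.toTemperedCurve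
  have hcyc' : ((cuspPairOf M.toTemperedCurve x).pushforward M.inclX).IsCyclotomic e.augC.toMonoidHom := by
    rw [CuspPair.isCyclotomic_pushforward_iff _ M.continuous_inclX (M.isClosedEmbedding_inclX e).isEmbedding, augC_comp_inclX]
    exact hcyc
  have hDc' : IsCompact ((((cuspPairOf M.toTemperedCurve x).pushforward M.inclX).D : Set M.GtpC)) := by
    change IsCompact ((((M.decomp x).map M.inclX : Subgroup M.GtpC)) : Set M.GtpC)
    rw [Subgroup.coe_map]
    exact hDc.image M.continuous_inclX
  have hI' : ∀ y ∈ ((cuspPairOf M.toTemperedCurve x).pushforward M.inclX).D,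
      y ∈ ((cuspPairOf M.toTemperedCurve x).pushforward M.inclX).I ↔ e.augC y = 1 := by
    rintro _ ⟨d, hd, rfl⟩
    change M.inclX d ∈ (M.inertia x).map M.inclX ↔ e.augC (M.inclX d) = 1
    rw [Subgroup.mem_map_iff_mem M.injective_inclX, e.augC_inclX]
    exact ⟨fun h => h.2, fun h => ⟨hd, h⟩⟩
  have hrat' : ((cuspPairOf M.toTemperedCurve x).pushforward M.inclX).D.map e.augC.toMonoidHom = M.toTemperedCurve.GK := by
    change ((M.decomp x).map M.inclX).map e.augC.toMonoidHom = _
    rw [Subgroup.map_map, augC_comp_inclX]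
    exact hrat
  exact ((cuspPairOf M.toTemperedCurve x).pushforward M.inclX).nonempty_completion_mulEquiv_resKer_of_isCyclotomic e.augC
    ↥M.toTemperedCurve.K (fun n => finiteIndex_range_powMonoidHom_units_padic (p := p) ↥M.toTemperedCurve.K n n.ne_zero)
    M.toTemperedCurve.GK Φ ι.toRingEquiv (fun σ y => hΦ σ y) hcyc' hDc' hI' hrat' (map_inclX_mem_splittings e hS₀)

include hx hD hS₀ in
/-- **The (gen) binder of the EtTh:Thm1.10(iii) END-KNIT closers FROM PRINT-LEVEL CLAUSES.**  Given a C-level datum `e`, a cusp `x` with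
`D_x ≤ Π^tp_Ẍ` and a splitting `S₀` — the inputs of p447306 / p454786 — and the print-level clauses «`I_x ≅ Ẑ(1)`» (`IsCyclotomicCusp`,
C7e (1)), «`D_x` compact», «`aug(D_x) = G_K`»: there is a cusp datum `C : M.DotCCusp εZ` over `(inclX D_x, inclX I_x)` whose
`(K^×)^∧`-torsor IS the genuine `H¹`-torsor (`IsGenuineTorsor`, C7e (2)) AND whose inertia is cyclotomic (`IsCyclotomicInertia`, C7e (1))
— the `κ : (K^×)^∧ ≃* Ker(res)` fed to `ofStructureGroupIso` is inflation + «`D/I = G_K`» + «`I = Ẑ(1)`» + Kummer, as in print.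
[cite: MochizukiEtTh2009, Thm 1.10 (iii) p.30] -/
theorem exists_isGenuineTorsor_and_isCyclotomicInertia_of_isCyclotomicCusp (hcyc : IsCyclotomicCusp M.toTemperedCurve x)
    (hDc : IsCompact (M.decomp x : Set M.PiTemp)) (hrat : (M.decomp x).map M.aug.toMonoidHom = M.toTemperedCurve.GK) :
    haveI := M.t1Space_GtpC e
    ∃ C : M.DotCCusp εZ, C.IsGenuineTorsor ∧ C.IsCyclotomicInertia ∧
      C.pair = (cuspPairOf M.toTemperedCurve x).pushforward M.inclX := by
  haveI := M.t1Space_GtpC e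
  obtain ⟨κ⟩ := nonempty_kxHat_mulEquiv_resKer_pushforward_of_isCyclotomicCusp e hx hS₀ hcyc hDc hrat
  refine ⟨ofStructureGroupIso e εZ hx hD hS₀ κ, isGenuineTorsor_ofStructureGroupIso e εZ hx hD hS₀ κ, ?_, rfl⟩
  change ((cuspPairOf M.toTemperedCurve x).pushforward M.inclX).IsCyclotomic e.augC.toMonoidHom
  rw [CuspPair.isCyclotomic_pushforward_iff _ M.continuous_inclX (M.isClosedEmbedding_inclX e).isEmbedding, augC_comp_inclX]
  exact hcyc

end MuTwoSetting.DotCCusp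

end Literature.AnabelianGeometry.EtaleTheta

end
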